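import Summits.BirchSwinnertonDyer.BirchSwinnertonDyer.Theorems.UniversalToricDescentHeegnerClassKummerBridge
import HarnessLib

/-!
# K1 ⟹ the `Λ`-adic Heegner class is not divisible by `p` in `𝔖_p(K_∞)`

Support file for crux `stmt-BirchSwinnertonDyer-24737` (`TwinAlgMuZeroAtThree`, line `beta-road` v8, stub K2_struct ∣ β; brick E6 of
the LEAD's STUB BRIEF). The lead g22's Kummer bridge (`…HeegnerClassKummerBridge.loc_not_mem_augIdealP_of_layerIndivisible`) needs a
«layer-compatible» functional `loc : 𝔖 → Λ`; Howard's μ-argument needs LESS — only that the `Λ`-adic class `𝐳_∞` is not a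
`p`-multiple in `𝔖 = 𝔖_p(E/K_∞)`. This file proves exactly that from the K1 data of the line, with NO functional: if `𝐳_∞ = p·w`
then every precision-one component `proj_k(𝐳_∞)_1 ∈ H¹(Γ_{K_k}, E[p])` vanishes (constants act through `ℤ_p → ℤ/p`), while by
the component formula it is `α^{k+1}·δ(Q)` for a `p`-th root `Q` of the layer point `z_k`; restricting to `Γ_{K_k} ∩ D_𝔭` contradicts
the local `p`-indivisibility of `z_k` (K1).

* `proj_C_p_smul_one` — `proj_n(p·w)_1 = 0`.
* `not_mem_augIdealP_smul_top_of_layerIndivisible` — K1 at some layer `k` (for the subgroup `D`) ⟹ `𝐳_∞ ∉ p·𝔖`.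

With `𝔖` free of rank one (Howard Thm. B (i)) this gives `μ(𝔖/Λ𝐳_∞) = 0` by the landed
`…TwoSidedMuTransfer.isTorsion_and_muInvariant_eq_zero_of_not_mem_smul`. References: Bertolini–Darmon 1996 §2.5; Howard 2004 §2.3;
Castella 2024 §2.2.
-/

noncomputable section
open scoped Classical

set_option linter.dupNamespace false
set_option autoImplicit false

namespace Summit.BirchSwinnertonDyer.BirchSwinnertonDyer.Theorems.UniversalToricDescentHeegnerClassNotDivisible

open NumberField Field WeierstrassCurve
open Literature.NumberTheory.EllipticCurves Literature.NumberTheory.EllipticCurves.IwasawaAlgebra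
  Literature.NumberTheory.EllipticCurves.Castella2024
open Summit.BirchSwinnertonDyer.BirchSwinnertonDyer.Theorems.UniversalToricDescentHeegnerClassKummerBridge

universe u

variable {K : Type u} [Field K] [NumberField K] {N : ℕ} [NeZero N] {W : WeierstrassCurve ℚ}
  {p : ℕ} [hp : Fact p.Prime] {κ : ZpExtension K p} {γ : Field.absoluteGaloisGroup K}
  {jbar : AlgebraicClosure K →+* ℂ}

/-- **Precision-one components of `p`-multiples vanish**: `proj_n (p · w)_1 = 0` in `H¹(Γ_{K_n}, E[p])` (constants act on the
`k`-th component through `ℤ_p → ℤ/p^k`, `LambdaAdicSelmerData.proj_C`). [cite: PerrinRiou1987BSMF, §0 p. 401] -/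
theorem proj_C_p_smul_one (Dat : (W.baseChange K).LambdaAdicSelmerData κ γ) (n : ℕ) (w : Dat.S) :
    Dat.proj n (PowerSeries.C (p : ℤ_[p]) • w) 1 = 0 := by
  rw [Dat.proj_C]
  change (((PadicInt.toZModPow 1 (p : ℤ_[p])).val : ℤ)) • Dat.proj n w 1 = 0
  rw [map_natCast, (ZMod.natCast_eq_zero_iff p (p ^ 1)).mpr (by rw [pow_one]), ZMod.val_zero, Nat.cast_zero, zero_smul]

/-- **K1 ⟹ `𝐳_∞ ∉ p·𝔖`.** Let `z ∈ 𝔖` be the `Λ`-adic Heegner class of the family `F` with sign `α` (`α² = 1`) and `D ≤ Γ_K` a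
subgroup. If for some layer `k` every `p`-th root `Q` of the norm point `z_k = F.z k` has NON-ZERO Kummer class over `Γ_{K_k} ∩ D`
(K1: the layer point is locally `p`-indivisible), then `z` is not a `p`-multiple in `𝔖`: `z ∉ (p)·𝔖`.
[cite: BertoliniDarmon1996, §2.5 eq. (7)–(8)] [cite: Howard2004HeegnerKolyvagin, §2.3 (proof of Thm. B)] -/
theorem not_mem_augIdealP_smul_top_of_layerIndivisible
    (Dat : (W.baseChange K).LambdaAdicSelmerData κ γ) (F : HeegnerFamily N W K κ jbar)
    {α : ℤ} (hα : α ^ 2 = 1) {z : Dat.S} (hz : IsLambdaAdicHeegnerClass Dat F α z)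
    (Dg : Subgroup (Field.absoluteGaloisGroup K))
    (hK1 : ∃ k : ℕ, ∀ (Q : geomPoints (W.baseChange K))
      (hQ : ∀ σ ∈ κ.layerSubgroup k ⊓ Dg, σ • (((p : ℤ) ^ 1) • Q) = ((p : ℤ) ^ 1) • Q),
      ((p : ℤ) ^ 1) • Q = F.z k →
        (W.baseChange K).kummerClassOver (κ.layerSubgroup k ⊓ Dg) ((p : ℤ) ^ 1) Q hQ ≠ 0) :
    z ∉ (augIdealP p • (⊤ : Submodule (IwasawaAlgebra p) Dat.S)) := by
  intro hmem
  rw [augIdealP, Submodule.ideal_span_singleton_smul, Submodule.mem_smul_pointwise_iff_exists] at hmem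
  obtain ⟨w, -, rfl⟩ := hmem
  obtain ⟨k, hk⟩ := hK1
  have hp1 : ((p : ℤ) ^ 1) ≠ 0 := pow_ne_zero _ (by exact_mod_cast (Fact.out : p.Prime).ne_zero)
  obtain ⟨Q, hQ⟩ := (W.baseChange K).zsmul_geomPoints_surjective_of_charZero hp1 (F.z k)
  dsimp only at hQ
  have hfix : ∀ σ ∈ κ.layerSubgroup k ⊓ Dg, σ • (((p : ℤ) ^ 1) • Q) = ((p : ℤ) ^ 1) • Q := fun σ hσ ↦ by
    rw [hQ]; exact (F.isHeegnerNormPoint_z k).smul_eq_self (inf_le_left (b := Dg) hσ)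
  have h0 : Dat.proj k (PowerSeries.C (p : ℤ_[p]) • w) 1 = 0 := proj_C_p_smul_one Dat k w
  rw [hz.proj_eq k 1 Q hQ] at h0
  have h1 := congrArg (Literature.NumberTheory.EllipticCurves.resOfLe (geomTorsion (W.baseChange K) ((p : ℤ) ^ 1))
    (inf_le_left : κ.layerSubgroup k ⊓ Dg ≤ κ.layerSubgroup k)) h0
  rw [map_zsmul, WeierstrassCurve.resOfLe_kummerClassOver, map_zero] at h1
  exact hk Q hfix hQ (zsmul_eq_zero_of_sq_eq_one hα k h1)

/-- The same in the shape consumed by `…TwoSidedMuTransfer.isTorsion_and_muInvariant_eq_zero_of_not_mem_smul`: `𝐳_∞` is not of the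
form `p · v`. [cite: Howard2004HeegnerKolyvagin, §2.3 (proof of Thm. B)] -/
theorem not_exists_eq_natCast_smul_of_layerIndivisible
    (Dat : (W.baseChange K).LambdaAdicSelmerData κ γ) (F : HeegnerFamily N W K κ jbar)
    {α : ℤ} (hα : α ^ 2 = 1) {z : Dat.S} (hz : IsLambdaAdicHeegnerClass Dat F α z)
    (Dg : Subgroup (Field.absoluteGaloisGroup K))
    (hK1 : ∃ k : ℕ, ∀ (Q : geomPoints (W.baseChange K))
      (hQ : ∀ σ ∈ κ.layerSubgroup k ⊓ Dg, σ • (((p : ℤ) ^ 1) • Q) = ((p : ℤ) ^ 1) • Q),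
      ((p : ℤ) ^ 1) • Q = F.z k →
        (W.baseChange K).kummerClassOver (κ.layerSubgroup k ⊓ Dg) ((p : ℤ) ^ 1) Q hQ ≠ 0) :
    ¬ ∃ v : Dat.S, z = (p : IwasawaAlgebra p) • v := by
  rintro ⟨v, hv⟩
  refine not_mem_augIdealP_smul_top_of_layerIndivisible Dat F hα hz Dg hK1 ?_
  have hCp : (p : IwasawaAlgebra p) = PowerSeries.C (p : ℤ_[p]) := by rw [map_natCast]
  rw [hv, hCp]
  exact Submodule.smul_mem_smul (Ideal.mem_span_singleton_self _) Submodule.mem_top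

end Summit.BirchSwinnertonDyer.BirchSwinnertonDyer.Theorems.UniversalToricDescentHeegnerClassNotDivisible

end
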